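import Literature.NumberTheory.Sieve.QuadraticRootsPrimeModuliDFILinear
import Literature.NumberTheory.Sieve.QuadraticRootsPrimeModuliDFIBilinear
import HarnessLib

/-!
# Duke–Friedlander–Iwaniec 1995, §7 (iv): the theorem from Theorem 5 and Propositions 1, 2 (PROVED)

Topic `Literature/NumberTheory/Sieve`.  Final layer of the level-2 decomposition of the named
fact `Literature.NumberTheory.Sieve.dukeFriedlanderIwaniec1995_quadraticRoots_primeModuli`
(for `f = aX² + 2bX + c`, `ac − b² > 0`, `h ≠ 0`: `∑_{p ≤ x} ρ_h(p) = o(π(x))`; W. Duke,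
J. B. Friedlander, H. Iwaniec, Ann. of Math. 141 (1995), Theorem p. 424), i.e. the whole of §7 of
the paper in Lean:

* `dukeFriedlanderIwaniec1995_quadraticRoots_primeModuli_of_theorem5 :
    dukeFriedlanderIwaniec1995_theorem5 → dukeFriedlanderIwaniec1995_proposition1 →
    dukeFriedlanderIwaniec1995_proposition2 → dukeFriedlanderIwaniec1995_quadraticRoots_primeModuli`
  (`DFI1995.isLittleO_sum_primesLE_of_theorem5` with (34) from `DFI1995.hyp34_of_proposition1` and
  (35) from `DFI1995.hyp35_of_proposition2`; `h < 0` by conjugation, `ρ_{−h} = conj ∘ ρ_h`);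
* `dukeFriedlanderIwaniecToth_quadraticRoots_primeModuli_of_theorem5_of_toth` — the same for the
  merged fact of `PolynomialCongruences.lean`, given Tóth's theorem for positive discriminant.

Trust base of the resulting conditional proof of the DFI fact: exactly the paper's own stated
results — Theorem 5 (§6, an elementary sieve identity for complex sequences), Proposition 1 and
Proposition 2 (both consequences of Proposition 4, the spectral bound for the Poincaré series on
`Γ₀(q)`: spectral theorem, Kuznetsov's formula, Weil's bound).

## References

* W. Duke, J. B. Friedlander, H. Iwaniec, Ann. of Math. (2) 141 (1995), 423–441, §7 p. 438.
  [cite: DukeFriedlanderIwaniec1995, §7]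
-/

namespace Literature.NumberTheory.Sieve

open scoped BigOperators Polynomial
open Filter Asymptotics Finset Polynomial

/-- **Duke–Friedlander–Iwaniec's theorem from the architecture of its proof (§7 of the paper,
PROVED).**  DFI's Theorem 5 (the sieve for complex sequences, §6), Proposition 1 (linear forms,
giving (34) for `ρ_h`: `DFI1995.hyp34_of_proposition1`) and Proposition 2 (bilinear forms, giving
(35) for `ρ_h`: `DFI1995.hyp35_of_proposition2`) give, for every `f = aX² + 2bX + c ∈ ℤ[X]` with
`ac − b² > 0` and every `h ≠ 0`, `∑_{p ≤ x} ρ_h(p) = o(π(x))` — the named fact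
`dukeFriedlanderIwaniec1995_quadraticRoots_primeModuli` (`h < 0` by complex conjugation,
`ρ_{−h} = conj ∘ ρ_h`). [cite: DukeFriedlanderIwaniec1995, §7 p. 438] -/
theorem dukeFriedlanderIwaniec1995_quadraticRoots_primeModuli_of_theorem5
    (H5 : dukeFriedlanderIwaniec1995_theorem5) (H1 : dukeFriedlanderIwaniec1995_proposition1)
    (H2 : dukeFriedlanderIwaniec1995_proposition2) :
    dukeFriedlanderIwaniec1995_quadraticRoots_primeModuli := by
  intro a b c hD h hh
  change (fun P : ℕ => ∑ p ∈ Nat.primesLE P, polyRootWeylSum (DFI1995.quad a b c) p h) =o[atTop]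
    fun P : ℕ => (Nat.primeCounting P : ℝ)
  have key : ∀ m : ℕ, 1 ≤ m →
      (fun P : ℕ => ∑ p ∈ Nat.primesLE P, polyRootWeylSum (DFI1995.quad a b c) p (m : ℤ))
        =o[atTop] fun P : ℕ => (Nat.primeCounting P : ℝ) := fun m hm =>
    DFI1995.isLittleO_sum_primesLE_of_theorem5 H5 hD (h := m)
      (fun ε hε hε12 => DFI1995.hyp34_of_proposition1 H1 hD hm hε hε12)
      (fun ε hε hε12 => DFI1995.hyp35_of_proposition2 H2 hD hm hε hε12)
  rcases lt_or_gt_of_ne hh with hneg | hpos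
  · -- `h < 0`: conjugate
    obtain ⟨m, hm⟩ := Int.exists_eq_neg_ofNat (le_of_lt hneg)
    have hm1 : 1 ≤ m := by omega
    refine IsLittleO.of_norm_left ?_
    have hnorm : ∀ P : ℕ, ‖∑ p ∈ Nat.primesLE P, polyRootWeylSum (DFI1995.quad a b c) p h‖ =
        ‖∑ p ∈ Nat.primesLE P, polyRootWeylSum (DFI1995.quad a b c) p (m : ℤ)‖ := by
      intro P
      rw [hm, show (-(m : ℤ) : ℤ) = -((m : ℕ) : ℤ) from rfl]
      simp_rw [polyRootWeylSum_neg]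
      rw [← map_sum, RCLike.norm_conj]
    simp_rw [hnorm]
    exact (key m hm1).norm_left
  · obtain ⟨m, hm⟩ := Int.eq_ofNat_of_zero_le (le_of_lt hpos)
    have hm1 : 1 ≤ m := by omega
    rw [hm]
    exact key m hm1

/-- The same for the merged fact: with Tóth's theorem for positive discriminant, DFI's Theorem 5
and Propositions 1, 2 give `dukeFriedlanderIwaniecToth_quadraticRoots_primeModuli`. [folklore] -/
theorem dukeFriedlanderIwaniecToth_quadraticRoots_primeModuli_of_theorem5_of_toth
    (H5 : dukeFriedlanderIwaniec1995_theorem5) (H1 : dukeFriedlanderIwaniec1995_proposition1)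
    (H2 : dukeFriedlanderIwaniec1995_proposition2) (hT : toth2000_quadraticRoots_primeModuli) :
    dukeFriedlanderIwaniecToth_quadraticRoots_primeModuli :=
  dukeFriedlanderIwaniecToth_quadraticRoots_primeModuli_of_dfi_of_toth
    (dukeFriedlanderIwaniec1995_quadraticRoots_primeModuli_of_theorem5 H5 H1 H2) hT

end Literature.NumberTheory.Sieve
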